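import Literature.NumberTheory.QuadraticForms.MeyerOfQuinary
import Literature.NumberTheory.QuadraticForms.MeyerRat
import Literature.NumberTheory.QuadraticForms.HasseMinkowskiOfMeyer
import Literature.NumberTheory.QuadraticForms.PadicHilbertSymbol
import HarnessLib

/-!
# Meyer's theorem and the Hasse–Minkowski theorem over `ℚ`: discharge of the named facts

Topic `NumberTheory/QuadraticForms`; namespace `Literature.NumberTheory.QuadraticForms`. Everything
here is proved. This file closes the named facts

* `meyer` (`Meyer.lean`; Serre, *A Course in Arithmetic*, Ch. IV §3.2 Cor. 2: an indefinite
  nondegenerate rational quadratic form of rank `≥ 5` represents `0`) — `meyer_holds`;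
* `hasseMinkowski` (`HasseMinkowski.lean`; Ch. IV §3.2 Thm 8) — `hasseMinkowski_holds`;

from the tree's theorems: the rank-`5` diagonal case of Meyer's theorem
`exists_quinary_zero_rat_of_indefinite` (`MeyerRat.lean`, Serre's step `n = 5` of Thm 8 by the
approximation theorem and the case `n = 4`), giving `QuinaryHasseMinkowskiRat`
(`quinaryHasseMinkowskiRat_holds`), whence `meyer` by `meyer_of_quinaryHasseMinkowskiRat`
(reduction to diagonal forms, `meyer_of_diagonal`, and Thm 6 (iv) at the finite places), and
`hasseMinkowski` by `hasseMinkowski_of_meyer` (ranks `2, 3, 4` from `exists_binary_zero_rat`,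
Legendre, Dirichlet; ranks `≥ 5` from `meyer`). The third named fact of `HasseMinkowski.lean`,
`padic_representsZero_of_five_le` (Thm 6 (iv) over `ℚ_[p]`), is `padic_representsZero_of_five_le_holds`
(`PadicHilbertSymbol.lean`); `meyer_of_hasseMinkowski` recovers `meyer` from the two once more.

Consequence (in `Literature/Topology/FourManifolds/LatticeFormsRepresentsZeroProofs.lean`):
Serre's Theorem V.3 — an indefinite unimodular lattice represents zero —
`exists_isotropic_of_isIndefinite_holds`.

## References

* J.-P. Serre, *A Course in Arithmetic*, GTM 7, Springer 1973, Ch. IV §3.2 Thm 8 and Cor. 2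
  (PDF pp. 39–41). [Serre1973]
-/

namespace Literature.NumberTheory.QuadraticForms

/-- **Hasse–Minkowski for diagonal quinary forms over `ℚ`** (`QuinaryHasseMinkowskiRat`, Serre
Ch. IV §3.2 Thm 8, `n = 5`): from `exists_quinary_zero_rat_of_indefinite` (`MeyerRat.lean`), the
local hypotheses at the finite places being superfluous in rank `5` (Thm 6 (iv)).
[cite: Serre1973, Ch. IV §3.2 Thm 8 (iv)] -/
theorem quinaryHasseMinkowskiRat_holds : QuinaryHasseMinkowskiRat := by
  intro a ha _ hpos hneg
  obtain ⟨x, hx0, hx⟩ := exists_quinary_zero_rat_of_indefinite (ha 0) (ha 1) (ha 2) (ha 3) (ha 4)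
    (fun h => hpos fun i => by fin_cases i <;> tauto)
    (fun h => hneg fun i => by fin_cases i <;> tauto)
  exact ⟨x, hx0, by rw [Fin.sum_univ_five]; exact hx⟩

/-- **Meyer's theorem** (discharge of the named fact `meyer`; Serre, *A Course in Arithmetic*,
Ch. IV §3.2 Cor. 2: "A quadratic form of rank `≥ 5` represents `0` if and only if it is
indefinite"): every symmetric `A ∈ Mₙ(ℚ)`, `n ≥ 5`, `det A ≠ 0`, whose form takes both signs on
`ℚⁿ` has a non-trivial rational zero. [cite: Serre1973, Ch. IV §3.2 Cor. 2] -/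
theorem meyer_holds : meyer :=
  meyer_of_quinaryHasseMinkowskiRat quinaryHasseMinkowskiRat_holds

/-- **The Hasse–Minkowski theorem** (discharge of the named fact `hasseMinkowski`; Serre,
*A Course in Arithmetic*, Ch. IV §3.2 Thm 8: a nondegenerate rational quadratic form which
represents `0` in `ℝ` and in every `ℚ_p` represents `0` in `ℚ`).
[cite: Serre1973, Ch. IV §3.2 Thm 8] -/
theorem hasseMinkowski_holds : hasseMinkowski :=
  hasseMinkowski_of_meyer meyer_holds

/-- Consistency check: Meyer's theorem recovered from its two printed inputs, now both proved
(`meyer_of_hasseMinkowski`, Serre Ch. IV §3.2, proof of Cor. 2). [cite: Serre1973, Ch. IV §3.2 Cor. 2] -/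
theorem meyer_holds' : meyer :=
  meyer_of_hasseMinkowski hasseMinkowski_holds padic_representsZero_of_five_le_holds

end Literature.NumberTheory.QuadraticForms
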